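/- Copyright: ym3-torus cell, WIDTH-5 ATTACH seat `ym-ust-19936-w4` (prover, g10), for crux `HistoryTailL` (stmt-QuantumFields-19936),
level-0 prefactor-free infrastructure (T4-UP, brick U3b) of LINE `local_insertion` (#13) ∕ K1.  Released under the licence of the surrounding project. -/
import Summits.QuantumFields.YangMills.Theorems.LocalInsertionTorusUpperAxisD3Prep
import HarnessLib

/-!
# (T4-UP, U3b) The holonomy-conditioned triangular UPPER bound on the THREE-torus:
# `Z_L(b∕2) ≤ (C·(b∕4)^{−D∕2})^{2L³−2} · Z₁(b∕(4L²))` — d = 3 port of ✓`…CTorusUpperAxis.torus_upper_axisHolonomy`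

Support file (`--supports stmt-QuantumFields-19936 --as helper`), cell ym3-torus level-0 programme, stage (T4) «uniform doubling» (LEAD ★w1-19936 g7
00:35:51Z ∕ 00:47:49Z; split ★w7 = T4-LOW, ★w4 = T4-UP).  For every compact second-countable `G` with a lattice representation `r`
(`D = dimE r.ρ`) there is `C > 0` (the one-link Laplace constant of ✓`oneLinkLaplace_le_rpow`) with, for all `L ≥ 2`, `b ≥ 4`,

  `Z_L(b∕2) ≤ (C·(b∕4)^{−D∕2})^{2L³ − 2} · Z₁(b∕(4L²))`      (`Z_L = partitionFunction (d := 3) (L := L) r.ρ`, `Z₁ = … (L := 1)`):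

`e^{−(b∕2)S} = e^{−(b∕4)S}·e^{−(b∕4)S}`; the first factor is at most the product of the plaquette weights at `b∕4` over the SHARP top-link
family of ✓`torus_topLink_assignment_sharp_offAxis_d3` (`2L³ − 2` private plaquettes, none with an axis top link); the second is at most the
SPECTATOR `exp(−(b∕(4L²))·f(h(U)))`, `h_μ(U)` the three based axis holonomies, by the every-d Stokes bound
✓`axisCommutatorCost_le_wilsonAction_general`; triangular integration with a spectator (✓`lintegral_mul_prod_le_pow_mul_lintegral`, generic)
and the product-Haar law of `h` (✓`map_axisHolonomy_pi_haar_d3`) give the claim, the spectator integrating to `Z₁(b∕(4L²))`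
(✓`OneSiteD3.wilsonAction_eq_commutatorCost`).  With ★w7's T4-LOW (`Z_L(b) ≥ e^{−…}·(c·b^{−D∕2})^{2L³−2}·Z₁(…)`-shape, axis
holonomies conditioned) the exponents MATCH EXACTLY (`2L³ − 2` both sides): the (T4) sandwich has `L`-independent slack — the
γ-uniform cure of the `β^{c∕n}` residual of ✓`LocalInsertionExpMomentSU2Torus`.

HONEST SCOPE.  A d = 3 port of a landed d = 4 theorem; nothing of the doubling (T4-ONE∕T4-ALL), of (EQ1)∕GOOD-1, of LINE #13's stubs, of
`HistoryTailL` or of any crux is proved.  YM₃ on T³ is rung R3 — not d = 4, not infinite volume, not a mass gap, not Clay.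
-/

set_option autoImplicit false

noncomputable section

open scoped ENNReal
open MeasureTheory Finset
open Literature.MathematicalPhysics.QuantumFieldTheory
open Summit.QuantumFields.YangMills.Theorems.FreeEnergyLogCoefficient (dimE)
open Summit.QuantumFields.YangMills.Theorems.FemtoCurvatureTwoPoint.PlaquetteVariance
  (partitionFunction_toReal_pos re_trace_le)
open Summit.QuantumFields.YangMills.Theorems.FemtoCurvatureTwoPointC
open Summit.QuantumFields.YangMills.Theorems.FemtoCurvatureTwoPointC.TorusGauge
  (lintegral_mul_prod_le_pow_mul_lintegral)

namespace Summit.QuantumFields.YangMills.Theorems.LocalInsertion.TorusUpperAxisD3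

-- adapted from Summits/QuantumFields/YangMills/Theorems/LangevinControlUVFemtoCurvatureTwoPointCTorusUpperAxis.lean (d = 4 → d = 3)

/-! ### The registered statement -/

/-- **Holonomy-conditioned triangular upper bound for the torus partition function** (d = 3 port of ✓`torus_upper_axisHolonomy`): there is `C > 0` (the one-link Laplace constant) with
`Z_L(b/2) ≤ (C (b/4)^{−D/2})^{2L³−2} · Z₁(b/(4L²))` on `(ℤ/L)³` for all `L ≥ 2`, `b ≥ 4`, `D = dimE r.ρ`,
`Z₁ = partitionFunction (L := 1)` — see the module docstring. -/
theorem torus_upper_axisHolonomy_d3 :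
    ∀ {G : Type} [Group G] [TopologicalSpace G] [IsTopologicalGroup G] [CompactSpace G]
      [MeasurableSpace G] [BorelSpace G] [SecondCountableTopology G] (r : LatticeRep G),
      ∃ C : ℝ, 0 < C ∧ ∀ (L : ℕ) [NeZero L] (b : ℝ), 2 ≤ L → 4 ≤ b →
        (partitionFunction (d := 3) (L := L) r.ρ (b / 2)).toReal ≤
          (C * (b / 4) ^ (-((dimE r.ρ : ℝ) / 2))) ^ (2 * L ^ 3 - 2) *
            (partitionFunction (d := 3) (L := 1) r.ρ (b / (4 * (L : ℝ) ^ 2))).toReal := by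
  intro G _ _ _ _ _ _ _ r
  classical
  obtain ⟨C, hC, hlap⟩ :=
    FemtoCurvatureTwoPointC.oneLinkLaplace_le_rpow r.ρ r.continuous r.injective r.mem_unitary
  refine ⟨C, hC, fun L _ b hL hb => ?_⟩
  obtain ⟨P, top, rk, hrk, htop, hcard, hP⟩ := torus_topLink_assignment_sharp_offAxis_d3 L hL
  have hb4 : 1 ≤ b / 4 := by linarith
  have hb40 : 0 ≤ b / 4 := by linarith
  have hz0 : 0 ≤ C * (b / 4) ^ (-((dimE r.ρ : ℝ) / 2)) :=
    (mul_pos hC (Real.rpow_pos_of_pos (by linarith) _)).le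
  set t : ℝ := b / (4 * (L : ℝ) ^ 2) with ht
  have ht0 : 0 ≤ t := by positivity
  let links : Plaquette 3 L → Finset (Edge 3 L) := fun p =>
    {(p.1, p.2.1.1), (p.1.shift p.2.1.1, p.2.1.2), (p.1.shift p.2.1.2, p.2.1.1), (p.1, p.2.1.2)}
  let w : Plaquette 3 L → GaugeConfig 3 L G → ℝ≥0∞ := fun p U => ENNReal.ofReal
    (Real.exp (-(b / 4 * ((r.N : ℝ) - (r.ρ (plaquetteHolonomy U p.1 p.2.1.1 p.2.1.2)).trace.re))))
  let Ψ : GaugeConfig 3 L G → GaugeConfig 3 1 G := fun U e' => lineHolonomy U e'.2 L 0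
  let g : GaugeConfig 3 L G → ℝ≥0∞ := fun U =>
    ENNReal.ofReal (Real.exp (-t * wilsonAction r.ρ (Ψ U)))
  have hw1 : ∀ (p : Plaquette 3 L) (U : GaugeConfig 3 L G), w p U ≤ 1 := fun p U =>
    TorusGauge.TorusUpper.ofReal_boltzmann_le_one r.ρ r.continuous hb40 _
  have hΨm : Measurable Ψ := measurable_pi_lambda _ fun e' => measurable_lineHolonomy_d3 _ _ _
  have hEm : Measurable fun V : GaugeConfig 3 1 G =>
      ENNReal.ofReal (Real.exp (-t * wilsonAction r.ρ V)) :=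
    ENNReal.measurable_ofReal.comp (Real.measurable_exp.comp
      ((WilsonRP.measurable_wilsonAction r.ρ r.continuous).const_mul _))
  have hgm : Measurable g := hEm.comp hΨm
  -- (1) pointwise: `e^{-(b/2) S} ≤ g · ∏_{p ∈ P} w_p`
  have hpt : ∀ U : GaugeConfig 3 L G,
      ENNReal.ofReal (Real.exp (-(b / 2) * wilsonAction r.ρ U)) ≤ g U * ∏ p ∈ P, w p U := by
    intro U
    have hSt := axisCommutatorCost_le_wilsonAction_general r.ρ r.mem_unitary U
    rw [← OneSiteD3.wilsonAction_eq_commutatorCost r.ρ (Ψ U)] at hSt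
    have hS0 : 0 ≤ wilsonAction r.ρ U := Finset.sum_nonneg fun p _ =>
      sub_nonneg.2 (re_trace_le r.ρ r.continuous _)
    have h1 : Real.exp (-(b / 4) * wilsonAction r.ρ U) ≤ Real.exp (-t * wilsonAction r.ρ (Ψ U)) := by
      refine Real.exp_le_exp.2 ?_
      have : t * wilsonAction r.ρ (Ψ U) ≤ t * ((L : ℝ) ^ 2 * wilsonAction r.ρ U) :=
        mul_le_mul_of_nonneg_left hSt ht0
      have hcancel : t * ((L : ℝ) ^ 2 * wilsonAction r.ρ U) = b / 4 * wilsonAction r.ρ U := by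
        rw [ht]
        field_simp
      linarith
    have h2 : ENNReal.ofReal (Real.exp (-(b / 4) * wilsonAction r.ρ U)) ≤ ∏ p ∈ P, w p U := by
      have hall : ENNReal.ofReal (Real.exp (-(b / 4) * wilsonAction r.ρ U)) = ∏ p, w p U := by
        rw [← ENNReal.ofReal_prod_of_nonneg fun p _ => (Real.exp_pos _).le, ← Real.exp_sum]
        congr 1
        rw [wilsonAction, neg_mul, Finset.mul_sum, ← Finset.sum_neg_distrib]
      rw [hall]
      exact Finset.prod_le_prod_of_subset_of_le_one' (Finset.subset_univ P) fun p _ _ => hw1 p U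
    calc ENNReal.ofReal (Real.exp (-(b / 2) * wilsonAction r.ρ U))
        = ENNReal.ofReal (Real.exp (-(b / 4) * wilsonAction r.ρ U)) *
            ENNReal.ofReal (Real.exp (-(b / 4) * wilsonAction r.ρ U)) := by
          rw [← ENNReal.ofReal_mul (Real.exp_pos _).le, ← Real.exp_add]
          congr 2
          ring
      _ ≤ g U * ∏ p ∈ P, w p U :=
          mul_le_mul' (ENNReal.ofReal_le_ofReal h1) h2
  -- (2) triangular integration with the spectator
  have hmain : ∫⁻ U, g U * ∏ p ∈ P, w p U ∂(Measure.pi fun _ : Edge 3 L => haarProbability G) ≤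
      ENNReal.ofReal (C * (b / 4) ^ (-((dimE r.ρ : ℝ) / 2))) ^ P.card *
        ∫⁻ U, g U ∂(Measure.pi fun _ : Edge 3 L => haarProbability G) := by
    refine lintegral_mul_prod_le_pow_mul_lintegral (haarProbability G) P links top rk hrk htop
      (fun p hp => (hP p hp).1.1) (fun p hp => (hP p hp).1.2) w
      (fun p _ => TorusGauge.TorusUpper.measurable_weight r.ρ r.continuous (b / 4) p) (fun p _ U => hw1 p U)
      (fun p _ U V hUV => ?_) _ (fun p hp U => ?_) g hgm
      {e : Edge 3 L | ∀ ν : Fin 3, ν ≠ e.2 → e.1 ν = 0} (fun U V hUV => ?_) (fun p hp hmem => ?_)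
    · -- the weight of `p` depends only on the four links of `p`
      show ENNReal.ofReal _ = ENNReal.ofReal _
      rw [TorusUpperD3.plaquetteHolonomy_eq_of_eqOn p fun e he => hUV e (Finset.mem_coe.2 he)]
    · -- integrating out the top link of `p` gives the one-link Laplace integral at `b/4 ≥ 1`
      show ∫⁻ x, ENNReal.ofReal (Real.exp (-(b / 4 * ((r.N : ℝ) -
          (r.ρ (plaquetteHolonomy (Function.update U (top p) x) p.1 p.2.1.1 p.2.1.2)).trace.re))))
          ∂haarProbability G ≤ _
      rw [TorusUpperD3.lintegral_update_plaquetteHolonomy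
          (TorusGauge.TorusUpper.measurable_ofReal_boltzmann r.ρ r.continuous (b / 4)) hL U p (hP p hp).1.1,
        TorusGauge.TorusUpper.lintegral_ofReal_boltzmann r.ρ r.continuous (b / 4)]
      exact ENNReal.ofReal_le_ofReal (hlap (b / 4) hb4)
    · -- the spectator reads only axis links
      show ENNReal.ofReal (Real.exp (-t * wilsonAction r.ρ (Ψ U))) =
        ENNReal.ofReal (Real.exp (-t * wilsonAction r.ρ (Ψ V)))
      have hΨ : Ψ U = Ψ V := funext fun e' => lineHolonomy_zero_congr_axis_d3 e'.2 L fun e he => hUV e he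
      rw [hΨ]
    · -- no top link is an axis link
      obtain ⟨ν, hν, hne⟩ := (hP p hp).2
      exact hne (hmem ν hν)
  -- (3) the spectator integrates to the one-site partition function
  have hspec : ∫⁻ U, g U ∂(Measure.pi fun _ : Edge 3 L => haarProbability G) =
      partitionFunction (d := 3) (L := 1) r.ρ t := by
    show ∫⁻ U, ENNReal.ofReal (Real.exp (-t * wilsonAction r.ρ (Ψ U))) ∂_ = _
    rw [OneSiteD3.partitionFunction_eq_lintegral', ← map_axisHolonomy_pi_haar_d3 (G := G) L hL,
      lintegral_map hEm hΨm]
  have hcardP : P.card = 2 * L ^ 3 - 2 := by omega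
  have hZ : partitionFunction (d := 3) (L := L) r.ρ (b / 2) ≤
      ENNReal.ofReal (C * (b / 4) ^ (-((dimE r.ρ : ℝ) / 2))) ^ P.card *
        partitionFunction (d := 3) (L := 1) r.ρ t := by
    rw [OneSiteD3.partitionFunction_eq_lintegral' r.ρ (b / 2), ← hspec]
    exact (lintegral_mono fun U => hpt U).trans hmain
  have hZ1pos := partitionFunction_toReal_pos (d := 3) (L := 1) r.ρ r.continuous t
  have hZ1top : partitionFunction (d := 3) (L := 1) r.ρ t ≠ ⊤ := (ENNReal.toReal_pos_iff.1 hZ1pos).2.ne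
  have htop : ENNReal.ofReal (C * (b / 4) ^ (-((dimE r.ρ : ℝ) / 2))) ^ P.card *
      partitionFunction (d := 3) (L := 1) r.ρ t ≠ ⊤ :=
    ENNReal.mul_ne_top (ENNReal.pow_ne_top ENNReal.ofReal_ne_top) hZ1top
  calc (partitionFunction (d := 3) (L := L) r.ρ (b / 2)).toReal
      ≤ (ENNReal.ofReal (C * (b / 4) ^ (-((dimE r.ρ : ℝ) / 2))) ^ P.card *
          partitionFunction (d := 3) (L := 1) r.ρ t).toReal := ENNReal.toReal_mono htop hZ
    _ = (C * (b / 4) ^ (-((dimE r.ρ : ℝ) / 2))) ^ (2 * L ^ 3 - 2) *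
          (partitionFunction (d := 3) (L := 1) r.ρ t).toReal := by
        rw [ENNReal.toReal_mul, ENNReal.toReal_pow, ENNReal.toReal_ofReal hz0, hcardP]

end Summit.QuantumFields.YangMills.Theorems.LocalInsertion.TorusUpperAxisD3

end
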